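import Mathlib
import Summits.QuantumAdvantage.QuantumAdvantage.Theorems.MobiusLadderQuadraticDigitPhasesStubCompactLemmas
import Summits.QuantumAdvantage.QuantumAdvantage.Theorems.MobiusLadderQuadraticDigitPhasesStubOneCutKataiCS

/-!
# `QuadraticDigitPhases` (stmt-QuantumAdvantage-1391), line `Sketch` — stub `stub_blockSum`

Semantics of aligned dyadic blocks (pure bookkeeping).  Fix multipliers `p, q ≥ 1`, a polynomial `P` of
total degree `≤ 2` in the binary digits `x₀, …, x_{n-1}`, a cut `N ≤ n` and a high part `mhi`; for
`m = mhi·2^N + T`, `T < 2^N`: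

* `testBit_mul_block`: the digits of `p·m` below `N` are those of `p·T`, and the digits from `N` on are
  those of `p·mhi + ⌊pT/2^N⌋` (write `p·m = 2^N (p·mhi + ⌊pT/2^N⌋) + (pT mod 2^N)`).
* `split_sum` + `eval_split`: in the normal form `P(x) = c₀ + Σ_{i<j} a_{ij} xᵢxⱼ + Σᵢ ℓᵢ xᵢ`
  (`eval_bits_eq` of the compactness file) split every index at `N`: `P(digits of p·m) = Φᴺ(T) + G(c, π)`
  where `Φᴺ(T)` collects the pairs `i<j<N` and the linear terms `i<N` (a function of the low digits of
  `pT`), `π_j = Σ_{i<N} a_{ij} xᵢ` (`j ≥ N`) is the pending linear form, `c = ⌊pT/2^N⌋` the carry, and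
  `G` is an explicit function of `(c, π)` (and `mhi`).
* `abs_sum_le_fibers`: if `F(T) = s(T)·Ψ(σ(T))` with `|Ψ| ≤ 1` then `|Σ_T F(T)| ≤ Σ_σ |Σ_{T ∈ σ⁻¹(σ)} s(T)|`
  (regroup along the fibres of `σ`, triangle inequality).
* `stub_blockSum`: apply this with `σ(T) = (⌊pT/2^N⌋, ⌊qT/2^N⌋, πᵖ(T), π^q(T))`, `s(T) = (-1)^{Φᵖ+Φ^q}` and
  `Ψ = (-1)^{Gᵖ} (-1)^{G^q}` (signs are multiplicative on `ZMod 2`: `sign_add` of the one-cut Kátai file).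
-/

set_option linter.dupNamespace false -- D-0017: single-problem summit ⇒ `QuantumAdvantage.QuantumAdvantage` by design

namespace Summit.QuantumAdvantage.QuantumAdvantage.Theorems.MobiusLadderQuadraticDigitPhasesStubBlockSum

open Finset
open Summit.QuantumAdvantage.QuantumAdvantage.Theorems.MobiusLadderQuadraticDigitPhasesStubCompact
  (eval_bits_eq)
open Summit.QuantumAdvantage.QuantumAdvantage.Theorems.MobiusLadderQuadraticDigitPhasesStubOneCutKatai
  (sign_add)

/-- A product of two signs has absolute value `≤ 1`. -/
theorem abs_sign_mul_sign_le_one (A B : Prop) [Decidable A] [Decidable B] :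
    |(if A then (-1 : ℝ) else 1) * (if B then (-1 : ℝ) else 1)| ≤ 1 := by
  split_ifs <;> simp

/-- Digits of `r·(mhi·2^N + T)`: below `N` they are the digits of `r·T`, from `N` on they are the
digits of `r·mhi + ⌊rT/2^N⌋` (no hypothesis `T < 2^N` is needed). -/
theorem testBit_mul_block (r N mhi T i : ℕ) :
    Nat.testBit (r * (mhi * 2 ^ N + T)) i =
      if i < N then Nat.testBit (r * T) i else Nat.testBit (r * mhi + r * T / 2 ^ N) (i - N) := by
  have h : r * (mhi * 2 ^ N + T) = 2 ^ N * (r * mhi + r * T / 2 ^ N) + r * T % 2 ^ N := by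
    have := Nat.div_add_mod (r * T) (2 ^ N)
    rw [mul_add (2 ^ N), add_assoc, this]
    ring
  rw [h, Nat.testBit_two_pow_mul_add _ (Nat.mod_lt _ (by positivity))]
  split_ifs with hi
  · rw [Nat.testBit_mod_two_pow]
    simp [hi]
  · rfl

/-- Splitting the `ℕ`-indexed normal form at the cut `N`: low pairs and low linear terms, cross
pairs `i < N ≤ j` regrouped along the pending forms `Σ_{i<N} a_{ij} bᵢ`, and the high part. -/
theorem split_sum {R : Type*} [CommRing R] {n N : ℕ} (hN : N ≤ n) (c0 : R) (qd : ℕ → ℕ → R)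
    (ld x b y : ℕ → R) (hqd : ∀ i j, j < i → qd i j = 0)
    (hb : ∀ i, i < N → x i = b i) (hy : ∀ i, N ≤ i → x i = y i) :
    c0 + ((∑ i ∈ range n, ∑ j ∈ range n, qd i j * x i * x j) + ∑ i ∈ range n, ld i * x i) =
      ((∑ i ∈ range N, ∑ j ∈ range N, qd i j * b i * b j) + ∑ i ∈ range N, ld i * b i) +
        (∑ j ∈ Ico N n, y j * ∑ i ∈ range N, qd i j * b i) +
        (c0 + ((∑ i ∈ Ico N n, ∑ j ∈ Ico N n, qd i j * y i * y j) + ∑ i ∈ Ico N n, ld i * y i)) := by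
  have mN : ∀ i ∈ range N, x i = b i := fun i hi => hb i (mem_range.mp hi)
  have mI : ∀ i ∈ Ico N n, x i = y i := fun i hi => hy i (mem_Ico.mp hi).1
  simp_rw [← Finset.sum_range_add_sum_Ico _ hN]
  have e1 : ∑ i ∈ range N, (∑ j ∈ range N, qd i j * x i * x j + ∑ j ∈ Ico N n, qd i j * x i * x j) =
      ∑ i ∈ range N, ∑ j ∈ range N, qd i j * b i * b j +
        ∑ i ∈ range N, ∑ j ∈ Ico N n, qd i j * b i * y j := by
    rw [← Finset.sum_add_distrib]
    refine Finset.sum_congr rfl fun i hi => ?_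
    rw [mN i hi]
    congr 1
    · exact Finset.sum_congr rfl fun j hj => by rw [mN j hj]
    · exact Finset.sum_congr rfl fun j hj => by rw [mI j hj]
  have e2 : ∑ i ∈ Ico N n, (∑ j ∈ range N, qd i j * x i * x j + ∑ j ∈ Ico N n, qd i j * x i * x j) =
      ∑ i ∈ Ico N n, ∑ j ∈ Ico N n, qd i j * y i * y j := by
    refine Finset.sum_congr rfl fun i hi => ?_
    have h0 : ∑ j ∈ range N, qd i j * x i * x j = 0 :=
      Finset.sum_eq_zero fun j hj => by
        have hi' := (mem_Ico.mp hi).1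
        have hj' := mem_range.mp hj
        rw [hqd i j (by omega), zero_mul, zero_mul]
    rw [h0, zero_add, mI i hi]
    exact Finset.sum_congr rfl fun j hj => by rw [mI j hj]
  have e3 : ∑ i ∈ range N, ld i * x i = ∑ i ∈ range N, ld i * b i :=
    Finset.sum_congr rfl fun i hi => by rw [mN i hi]
  have e4 : ∑ i ∈ Ico N n, ld i * x i = ∑ i ∈ Ico N n, ld i * y i :=
    Finset.sum_congr rfl fun i hi => by rw [mI i hi]
  have e5 : ∑ i ∈ range N, ∑ j ∈ Ico N n, qd i j * b i * y j =
      ∑ j ∈ Ico N n, y j * ∑ i ∈ range N, qd i j * b i := by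
    rw [Finset.sum_comm]
    refine Finset.sum_congr rfl fun j _ => ?_
    rw [Finset.mul_sum]
    refine Finset.sum_congr rfl fun i _ => ?_
    ring
  rw [e1, e2, e3, e4, e5]
  ring

/-- The shape of the final regrouping `((l₁ + l₂) + x) + h = (l₁' + l₂') + (h + y)`. -/
theorem shape {R : Type*} [CommRing R] (l₁ l₂ l₁' l₂' x h y : R) (e₁ : l₁ = l₁') (e₂ : l₂ = l₂')
    (e₃ : x = y) : ((l₁ + l₂) + x) + h = (l₁' + l₂') + (h + y) := by
  rw [e₁, e₂, e₃]
  ring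

/-- SPLITTING THE PHASE at the cut `N`.  For every `T`, `P(digits of r·(mhi·2^N + T)) = Φᴺ_r(T) + G(⌊rT/2^N⌋, π_r(T))`
with `Φᴺ_r(T)` the low part (pairs `i<j<N`, linear `i<N`, in the digits of `rT`), `π_r(T)` the pending
forms and `G` a function of the carry and the pending forms only (for fixed `r, mhi, P, N`). -/
theorem eval_split (r n N : ℕ) (P : MvPolynomial (Fin n) (ZMod 2)) (hP : P.totalDegree ≤ 2)
    (hN : N ≤ n) (mhi : ℕ) :
    ∃ G : ℕ → (Fin n → ZMod 2) → ZMod 2, ∀ T : ℕ,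
      MvPolynomial.eval (fun i : Fin n => if Nat.testBit (r * (mhi * 2 ^ N + T)) i then (1 : ZMod 2) else 0) P =
        ((∑ i ∈ Finset.range N, ∑ j ∈ Finset.range N, (if i < j then (if h : i < n ∧ j < n then MvPolynomial.coeff (Finsupp.single (⟨i, h.1⟩ : Fin n) 1 + Finsupp.single (⟨j, h.2⟩ : Fin n) 1) P else 0) * (if Nat.testBit (r * T) i then (1 : ZMod 2) else 0) * (if Nat.testBit (r * T) j then (1 : ZMod 2) else 0) else 0)) + ∑ i ∈ Finset.range N, (if h : i < n then MvPolynomial.coeff (Finsupp.single (⟨i, h⟩ : Fin n) 1) P + MvPolynomial.coeff (Finsupp.single (⟨i, h⟩ : Fin n) 2) P else 0) * (if Nat.testBit (r * T) i then (1 : ZMod 2) else 0)) +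
        G (r * T / 2 ^ N) (fun j : Fin n => if N ≤ (j : ℕ) then ∑ i ∈ Finset.range N, (if h : i < n then MvPolynomial.coeff (Finsupp.single (⟨i, h⟩ : Fin n) 1 + Finsupp.single j 1) P else 0) * (if Nat.testBit (r * T) i then (1 : ZMod 2) else 0) else 0) := by
  obtain ⟨qd, hqd⟩ : ∃ qd : ℕ → ℕ → ZMod 2, ∀ i j, qd i j = if i < j then (if h : i < n ∧ j < n then
      MvPolynomial.coeff (Finsupp.single (⟨i, h.1⟩ : Fin n) 1 + Finsupp.single (⟨j, h.2⟩ : Fin n) 1) P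
        else 0) else 0 := ⟨_, fun _ _ => rfl⟩
  obtain ⟨ld, hld⟩ : ∃ ld : ℕ → ZMod 2, ∀ i, ld i = if h : i < n then
      MvPolynomial.coeff (Finsupp.single (⟨i, h⟩ : Fin n) 1) P +
        MvPolynomial.coeff (Finsupp.single (⟨i, h⟩ : Fin n) 2) P else 0 := ⟨_, fun _ => rfl⟩
  obtain ⟨y, hy⟩ : ∃ y : ℕ → ℕ → ZMod 2, ∀ c i,
      y c i = if Nat.testBit (r * mhi + c) (i - N) then 1 else 0 := ⟨_, fun _ _ => rfl⟩
  refine ⟨fun c π => (MvPolynomial.coeff 0 P + ((∑ i ∈ Finset.Ico N n, ∑ j ∈ Finset.Ico N n,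
      qd i j * y c i * y c j) + ∑ i ∈ Finset.Ico N n, ld i * y c i)) +
      ∑ j ∈ Finset.Ico N n, y c j * (if h : j < n then π ⟨j, h⟩ else 0), fun T => ?_⟩
  have hqd' : ∀ i j : Fin n, qd i j =
      if i < j then MvPolynomial.coeff (Finsupp.single i 1 + Finsupp.single j 1) P else 0 := by
    intro i j
    rw [hqd]
    simp [Fin.is_lt]
  have hld' : ∀ i : Fin n, ld i =
      MvPolynomial.coeff (Finsupp.single i 1) P + MvPolynomial.coeff (Finsupp.single i 2) P := by
    intro i
    rw [hld]
    simp [Fin.is_lt]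
  rw [eval_bits_eq P hP qd ld hqd' hld' (r * (mhi * 2 ^ N + T))]
  obtain ⟨b, hb⟩ : ∃ b : ℕ → ZMod 2, ∀ i, b i = if Nat.testBit (r * T) i then 1 else 0 :=
    ⟨_, fun _ => rfl⟩
  have hx1 : ∀ i, i < N →
      (if Nat.testBit (r * (mhi * 2 ^ N + T)) i then (1 : ZMod 2) else 0) = b i := by
    intro i hi
    rw [hb, testBit_mul_block, if_pos hi]
  have hx2 : ∀ i, N ≤ i →
      (if Nat.testBit (r * (mhi * 2 ^ N + T)) i then (1 : ZMod 2) else 0) = y (r * T / 2 ^ N) i := by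
    intro i hi
    rw [hy, testBit_mul_block, if_neg (not_lt.mpr hi)]
  have hq0 : ∀ i j, j < i → qd i j = 0 := fun i j h => by rw [hqd, if_neg (by omega)]
  rw [split_sum hN (MvPolynomial.coeff 0 P) qd ld
    (fun i => if Nat.testBit (r * (mhi * 2 ^ N + T)) i then (1 : ZMod 2) else 0) b (y (r * T / 2 ^ N))
    hq0 hx1 hx2]
  simp only [← hb]
  refine shape _ _ _ _ _ _ _ ?_ ?_ ?_
  · simp only [hqd, ite_mul, zero_mul]
  · simp only [hld]
  · refine Finset.sum_congr rfl fun j hj => ?_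
    obtain ⟨hj1, hj2⟩ := Finset.mem_Ico.mp hj
    rw [dif_pos hj2, if_pos hj1]
    congr 1
    refine Finset.sum_congr rfl fun i hi => ?_
    have hi' : i < N := Finset.mem_range.mp hi
    rw [hqd, if_pos (by omega), dif_pos ⟨by omega, hj2⟩, dif_pos (show i < n by omega)]


/-- REGROUPING ALONG FIBRES.  If `F i = sgn i · Ψ(a i, b i, u i, v i)` on `s` with `|Ψ| ≤ 1` and
`(a i, b i) ∈ A`, then `|Σ_{i ∈ s} F i| ≤ Σ_{x ∈ A} Σ_y Σ_z |Σ_{i ∈ s, (a,b,u,v)(i) = (x,y,z)} sgn i|`. -/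
theorem abs_sum_le_fibers {ι α β γ δ : Type*} [DecidableEq α] [DecidableEq β] [Fintype γ]
    [DecidableEq γ] [Fintype δ] [DecidableEq δ] (s : Finset ι) (A : Finset (α × β)) (a : ι → α)
    (b : ι → β) (u : ι → γ) (v : ι → δ) (hab : ∀ i ∈ s, (a i, b i) ∈ A) (F sgn : ι → ℝ)
    (Ψ : α → β → γ → δ → ℝ) (hΨ : ∀ a' b' u' v', |Ψ a' b' u' v'| ≤ 1)
    (hF : ∀ i ∈ s, F i = sgn i * Ψ (a i) (b i) (u i) (v i)) :
    |∑ i ∈ s, F i| ≤ ∑ x ∈ A, ∑ y : γ, ∑ z : δ,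
      |∑ i ∈ s.filter (fun i => a i = x.1 ∧ b i = x.2 ∧ u i = y ∧ v i = z), sgn i| := by
  have hmaps : ∀ i ∈ s, ((a i, b i), (u i, v i)) ∈
      A ×ˢ ((Finset.univ : Finset γ) ×ˢ (Finset.univ : Finset δ)) := fun i hi =>
    Finset.mem_product.mpr ⟨hab i hi, Finset.mem_product.mpr ⟨Finset.mem_univ _, Finset.mem_univ _⟩⟩
  rw [← Finset.sum_fiberwise_of_maps_to hmaps (f := F), Finset.sum_product]
  refine (Finset.abs_sum_le_sum_abs _ _).trans (Finset.sum_le_sum fun x _ => ?_)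
  rw [Finset.sum_product]
  refine (Finset.abs_sum_le_sum_abs _ _).trans (Finset.sum_le_sum fun y _ => ?_)
  refine (Finset.abs_sum_le_sum_abs _ _).trans (Finset.sum_le_sum fun z _ => ?_)
  have hfilter : s.filter (fun i => ((a i, b i), (u i, v i)) = (x, (y, z))) =
      s.filter (fun i => a i = x.1 ∧ b i = x.2 ∧ u i = y ∧ v i = z) :=
    Finset.filter_congr fun i _ => by simp only [Prod.ext_iff, and_assoc]
  rw [hfilter]
  have hsum : ∑ i ∈ s.filter (fun i => a i = x.1 ∧ b i = x.2 ∧ u i = y ∧ v i = z), F i =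
      (∑ i ∈ s.filter (fun i => a i = x.1 ∧ b i = x.2 ∧ u i = y ∧ v i = z), sgn i) *
        Ψ x.1 x.2 y z := by
    rw [Finset.sum_mul]
    refine Finset.sum_congr rfl fun i hi => ?_
    obtain ⟨his, h1, h2, h3, h4⟩ := Finset.mem_filter.mp hi
    rw [hF i his, h1, h2, h3, h4]
  rw [hsum, abs_mul]
  exact mul_le_of_le_one_right (abs_nonneg _) (hΨ _ _ _ _)

/-- SEMANTICS of aligned dyadic blocks (registered stub `stub_blockSum` of crux stmt-QuantumAdvantage-1391, line Sketch,
skeleton v22): the Kátai block sum is bounded by the ℓ¹ norm of the signed measure induced on the reduced carry-automaton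
states `(⌊pT/2^N⌋, ⌊qT/2^N⌋, π^y, π^z)`.  Proof: `eval_split` for `p` and for `q` writes each factor of the summand as
`(low sign) · (sign of a function of the state)` (`sign_add`), and `abs_sum_le_fibers` regroups along the state map
(`⌊pT/2^N⌋ < p` because `T < 2^N` and `0 < p`). -/
theorem stub_blockSum :
    ∀ (p q n N : ℕ) (P : MvPolynomial (Fin n) (ZMod 2)), P.totalDegree ≤ 2 → N ≤ n → 0 < p → 0 < q → ∀ mhi : ℕ,
      |∑ T ∈ Finset.range (2 ^ N), (if MvPolynomial.eval (fun i : Fin n => if Nat.testBit (p * (mhi * 2 ^ N + T)) i then (1 : ZMod 2) else 0) P = 1 then (-1 : ℝ) else 1) *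
          (if MvPolynomial.eval (fun i : Fin n => if Nat.testBit (q * (mhi * 2 ^ N + T)) i then (1 : ZMod 2) else 0) P = 1 then (-1 : ℝ) else 1)| ≤
        (∑ x ∈ Finset.range p ×ˢ Finset.range q, ∑ π : Fin n → ZMod 2, ∑ π' : Fin n → ZMod 2,
          |∑ T ∈ (Finset.range (2 ^ N)).filter (fun T => (p * T / 2 ^ N = x.1 ∧ q * T / 2 ^ N = x.2 ∧ (fun j : Fin n => if N ≤ (j : ℕ) then ∑ i ∈ Finset.range N, (if h : i < n then MvPolynomial.coeff (Finsupp.single (⟨i, h⟩ : Fin n) 1 + Finsupp.single j 1) P else 0) * (if Nat.testBit (p * T) i then (1 : ZMod 2) else 0) else 0) = π ∧ (fun j : Fin n => if N ≤ (j : ℕ) then ∑ i ∈ Finset.range N, (if h : i < n then MvPolynomial.coeff (Finsupp.single (⟨i, h⟩ : Fin n) 1 + Finsupp.single j 1) P else 0) * (if Nat.testBit (q * T) i then (1 : ZMod 2) else 0) else 0) = π')),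
            (if (((∑ i ∈ Finset.range N, ∑ j ∈ Finset.range N, (if i < j then (if h : i < n ∧ j < n then MvPolynomial.coeff (Finsupp.single (⟨i, h.1⟩ : Fin n) 1 + Finsupp.single (⟨j, h.2⟩ : Fin n) 1) P else 0) * (if Nat.testBit (p * T) i then (1 : ZMod 2) else 0) * (if Nat.testBit (p * T) j then (1 : ZMod 2) else 0) else 0)) + ∑ i ∈ Finset.range N, (if h : i < n then MvPolynomial.coeff (Finsupp.single (⟨i, h⟩ : Fin n) 1) P + MvPolynomial.coeff (Finsupp.single (⟨i, h⟩ : Fin n) 2) P else 0) * (if Nat.testBit (p * T) i then (1 : ZMod 2) else 0)) + ((∑ i ∈ Finset.range N, ∑ j ∈ Finset.range N, (if i < j then (if h : i < n ∧ j < n then MvPolynomial.coeff (Finsupp.single (⟨i, h.1⟩ : Fin n) 1 + Finsupp.single (⟨j, h.2⟩ : Fin n) 1) P else 0) * (if Nat.testBit (q * T) i then (1 : ZMod 2) else 0) * (if Nat.testBit (q * T) j then (1 : ZMod 2) else 0) else 0)) + ∑ i ∈ Finset.range N, (if h : i < n then MvPolynomial.coeff (Finsupp.single (⟨i, h⟩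 : Fin n) 1) P + MvPolynomial.coeff (Finsupp.single (⟨i, h⟩ : Fin n) 2) P else 0) * (if Nat.testBit (q * T) i then (1 : ZMod 2) else 0))) = 1 then (-1 : ℝ) else 1)|) := by
  intro p q n N P hP hN hp hq mhi
  obtain ⟨Gp, hGp⟩ := eval_split p n N P hP hN mhi
  obtain ⟨Gq, hGq⟩ := eval_split q n N P hP hN mhi
  refine abs_sum_le_fibers (Finset.range (2 ^ N)) (Finset.range p ×ˢ Finset.range q) _ _ _ _ ?_ _ _
    (fun a b u v => (if Gp a u = 1 then (-1 : ℝ) else 1) * (if Gq b v = 1 then (-1 : ℝ) else 1)) ?_ ?_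
  · intro T hT
    rw [Finset.mem_range] at hT
    refine Finset.mem_product.mpr ⟨Finset.mem_range.mpr ?_, Finset.mem_range.mpr ?_⟩
    · exact Nat.div_lt_of_lt_mul (by
        calc p * T < p * 2 ^ N := mul_lt_mul_of_pos_left hT hp
          _ = 2 ^ N * p := Nat.mul_comm _ _)
    · exact Nat.div_lt_of_lt_mul (by
        calc q * T < q * 2 ^ N := mul_lt_mul_of_pos_left hT hq
          _ = 2 ^ N * q := Nat.mul_comm _ _)
  · intro a b u v
    exact abs_sign_mul_sign_le_one _ _
  · intro T _
    rw [hGp T, hGq T]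
    simp only [sign_add]
    ring

end Summit.QuantumAdvantage.QuantumAdvantage.Theorems.MobiusLadderQuadraticDigitPhasesStubBlockSum
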